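import Mathlib.Algebra.CharP.Algebra
import Literature.RingTheory.MvPolynomial.RuppertGaoRank
import Literature.RingTheory.MvPolynomial.RuppertGaoSections
import Literature.RingTheory.MvPolynomial.RuppertGaoSectionsDistinct
import HarnessLib

/-!
# Gao–Ruppert reduction: the number of absolute factors does not grow modulo good primes

Assembly of `RuppertGaoRank.lean` (Gao's `dim ker R_φ = #factors` in rank form) with the generic
plane sections (`RuppertGaoSections*.lean`) for an INTEGER polynomial `Q ∈ ℤ[x₁, …, xₙ]`, in the
spirit of W. M. Ruppert, *Reducibility of polynomials `f(x, y)` modulo `p`*, J. Number Theory 77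
(1999) 62–70 (there: absolute irreducibility is preserved modulo all `p` larger than an explicit
height bound, via a non-vanishing maximal minor of `M(f)`; here the same mechanism with Gao's
count in place of irreducibility and the generic plane section in place of the bivariate
hypothesis):

* `Ruppert.exists_rupMinor_planeSect_ne_zero` — if `Q` (degree `d ≥ 1`) splits over an
  algebraically closed field of characteristic `0` as `c · w₁ ⋯ w_g` with `w_j` pairwise
  non-associated irreducible, then Ruppert's matrix of the generic section
  `planeSect Q ∈ (ℤ[z, μ, v])[X, Y]` has a non-zero minor `Δ ∈ ℤ[z, μ, v]` of size `N − g`;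
* `Ruppert.card_add_le_of_map_rupMinor_ne_zero` — for a prime `p > d` at which that minor does
  not vanish identically (`Δ mod p ≠ 0`) and `Q mod p ≠ 0`, every family of pairwise
  non-associated irreducible factors of `Q` over an algebraically closed field of characteristic
  `p` has at most `g` members (`r + (N − g) ≤ N`).

So for all `p > d` not dividing one fixed non-zero coefficient of `Δ`, `Q mod p` has at most as
many absolute factors as `Q` — with no height of any algebraic number entering. No definitions,
no named facts; helpers private.

## References

* W. M. Ruppert, J. Number Theory 77 (1999) 62–70, §2 (the minor criterion modulo `p`). [`Ruppert1999`]
* S. Gao, Math. Comp. 72 (2003) 801–822, Thm. 2.3. [`GaoPDE2003`]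
-/

noncomputable section

open MvPolynomial

namespace Literature.RingTheory.MvPolynomial

namespace Ruppert

open Literature.NumberTheory.DiophantineGeometry

variable {n : ℕ}

/-- `K[z, μ, v] → Ω` is injective. [folklore] -/
private theorem algebraMap_params_injective'' {K : Type*} [Field K] :
    Function.Injective (algebraMap (MvPolynomial (Params n) K)
      (AlgebraicClosure (FractionRing (MvPolynomial (Params n) K)))) := by
  rw [IsScalarTower.algebraMap_eq (MvPolynomial (Params n) K) (FractionRing (MvPolynomial (Params n) K))
    (AlgebraicClosure (FractionRing (MvPolynomial (Params n) K))), RingHom.coe_comp]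
  exact (algebraMap (FractionRing (MvPolynomial (Params n) K)) _).injective.comp
    (IsFractionRing.injective (MvPolynomial (Params n) K) (FractionRing (MvPolynomial (Params n) K)))

/-- The section of `c · ∏ w_j`, read over any ring. [folklore] -/
private theorem map_planeSect_C_mul_prod {K A : Type*} [Field K] [CommRing A]
    (ι : MvPolynomial (Params n) K →+* A) {r : ℕ} (c : K) (w : Fin r → MvPolynomial (Fin n) K) :
    MvPolynomial.map ι (planeSect (C c * ∏ j, w j)) =
      C (ι (C c)) * ∏ j, MvPolynomial.map ι (planeSect (w j)) := by
  rw [planeSect_eq_eval₂Hom, map_mul, map_prod, map_mul, map_prod, eval₂Hom_C, RingHom.comp_apply,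
    map_C]
  rfl

/-- Minors of the section of `Q` read over `Ω` come from the integer minors. [folklore] -/
private theorem rupMinor_map_planeSect_int {K A : Type*} [Field K] [CommRing A]
    (j : MvPolynomial (Params n) K →+* A) (Q : MvPolynomial (Fin n) ℤ) (d : ℕ) {k : ℕ}
    (rows : Fin k → (Fin 2 →₀ ℕ)) (cs : Fin k → Col d) :
    rupMinor d (MvPolynomial.map j (planeSect (MvPolynomial.map (Int.castRingHom K) Q))) rows cs =
      j (MvPolynomial.map (Int.castRingHom K) (rupMinor d (planeSect Q) rows cs)) := by
  rw [planeSect_map, rupMinor_map, rupMinor_map]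

/-- **A non-zero integer minor of size `N − g`** (characteristic zero). If `Q ∈ ℤ[x₁, …, xₙ]` of
degree `d ≥ 1` splits over an algebraically closed field `K` of characteristic zero as
`c · w₀ ⋯ w_{g−1}`, `w_j` pairwise non-associated irreducible, then some minor of size `N − g` of
Ruppert's matrix of `planeSect Q` is a non-zero element of `ℤ[z, μ, v]` (Gao's rank over
`Ω ⊇ K(z, μ, v)`, pulled back along the injective maps). [cite: GaoPDE2003, Thm. 2.3] -/
theorem exists_rupMinor_planeSect_ne_zero {K : Type*} [Field K] [IsAlgClosed K] [CharZero K]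
    (Q : MvPolynomial (Fin n) ℤ) (hd : 1 ≤ Q.totalDegree) {g : ℕ} {c : K} (hc : c ≠ 0)
    (w : Fin g → MvPolynomial (Fin n) K) (hw : ∀ j, Irreducible (w j))
    (hna : ∀ j k, j ≠ k → ¬ w j ∣ w k)
    (hQ : MvPolynomial.map (Int.castRingHom K) Q = C c * ∏ j, w j) :
    ∃ (k : ℕ) (_ : k + g = Fintype.card (Col Q.totalDegree)) (rows : Fin k → (Fin 2 →₀ ℕ))
      (cs : Fin k → Col Q.totalDegree), rupMinor Q.totalDegree (planeSect Q) rows cs ≠ 0 := by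
  classical
  set ι := algebraMap (MvPolynomial (Params n) K) (AlgebraicClosure (FractionRing (MvPolynomial (Params n) K)))
    with hι
  have hιinj : Function.Injective ι := algebraMap_params_injective''
  set φ := MvPolynomial.map ι (planeSect (MvPolynomial.map (Int.castRingHom K) Q)) with hφ
  have hdegK : (MvPolynomial.map (Int.castRingHom K) Q).totalDegree = Q.totalDegree :=
    totalDegree_map_of_injective' Q (Int.castRingHom K).injective_int
  have hdeg : φ.totalDegree = Q.totalDegree := by
    rw [hφ, totalDegree_map_planeSect, hdegK]
  have hφprod : φ = C (ι (C c)) * ∏ j, MvPolynomial.map ι (planeSect (w j)) := by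
    rw [hφ, hQ, map_planeSect_C_mul_prod]
  have hc' : ι (C c) ≠ 0 := (map_ne_zero_iff ι hιinj).mpr (C_ne_zero.mpr hc)
  obtain ⟨k, hk, rows, cs, hmin⟩ := exists_rupMinor_ne_zero_of_prod hdeg hd hc'
    (fun j => MvPolynomial.map ι (planeSect (w j)))
    (fun j => irreducible_map_planeSect (irreducible_map_of_isAlgClosed _ (hw j)))
    (fun j l hjl => not_dvd_map_planeSect (hw j) (hw l) (hna j l hjl)) hφprod
  refine ⟨k, hk, rows, cs, fun h0 => hmin ?_⟩
  rw [hφ, rupMinor_map_planeSect_int ι Q _ rows cs, h0, map_zero, map_zero]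

/-- **The count modulo a good prime.** Let `p` be a prime with `d < p`, `Q ∈ ℤ[x₁, …, xₙ]` of
degree `≤ d`, and suppose some minor of Ruppert's matrix of `planeSect Q` of size `k` does not
vanish identically modulo `p`. Then over any algebraically closed field `L` of characteristic `p`
in which `Q ≠ 0`, every family of pairwise non-associated irreducible factors of `Q` has at most
`N − k` members (the sections of the factors are independent kernel pairs of `R_φ`, `φ` the
section of `Q`; Ruppert's criterion "`det M₀ ≢ 0 mod p`"). [cite: Ruppert1999, §2] -/
theorem card_add_le_of_map_rupMinor_ne_zero {L : Type*} [Field L] [IsAlgClosed L] (p : ℕ)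
    [Fact p.Prime] [CharP L p] (Q : MvPolynomial (Fin n) ℤ) {d : ℕ} (hQd : Q.totalDegree ≤ d)
    (hpd : d < p) (hQ0 : MvPolynomial.map (Int.castRingHom L) Q ≠ 0)
    {k : ℕ} {rows : Fin k → (Fin 2 →₀ ℕ)} {cs : Fin k → Col d}
    (hmin : MvPolynomial.map (Int.castRingHom (ZMod p)) (rupMinor d (planeSect Q) rows cs) ≠ 0)
    {r : ℕ} (w : Fin r → MvPolynomial (Fin n) L) (hw : ∀ j, Irreducible (w j))
    (hna : ∀ j k, j ≠ k → ¬ w j ∣ w k) (hdvd : ∀ j, w j ∣ MvPolynomial.map (Int.castRingHom L) Q) :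
    r + k ≤ Fintype.card (Col d) := by
  classical
  set ι := algebraMap (MvPolynomial (Params n) L) (AlgebraicClosure (FractionRing (MvPolynomial (Params n) L)))
    with hι
  have hιinj : Function.Injective ι := algebraMap_params_injective''
  set φ := MvPolynomial.map ι (planeSect (MvPolynomial.map (Int.castRingHom L) Q)) with hφ
  -- characteristic `p > d` in `Ω`
  haveI : CharP (AlgebraicClosure (FractionRing (MvPolynomial (Params n) L))) p :=
    charP_of_injective_algebraMap (algebraMap L _).injective p
  have hchar : ∀ a : ℕ, 0 < a → a ≤ d →
      (a : AlgebraicClosure (FractionRing (MvPolynomial (Params n) L))) ≠ 0 := by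
    intro a ha had h0
    rw [CharP.cast_eq_zero_iff _ p] at h0
    exact absurd (Nat.le_of_dvd ha h0) (by omega)
  -- the section of `Q mod p` over `Ω`
  have hφ0 : φ ≠ 0 := by
    intro h0
    apply hQ0
    have h1 : planeSect (MvPolynomial.map (Int.castRingHom L) Q) = 0 :=
      MvPolynomial.map_injective ι hιinj (by rw [← hφ, h0, map_zero])
    -- specialise `X, Y ↦ 0`: `planeSect f ↦ f(μ)`, an injective renaming
    have h2 := congrArg (MvPolynomial.aeval (fun _ : Fin 2 => (0 : MvPolynomial (Params n) L))) h1
    rw [map_zero, planeSect_eq_eval₂Hom] at h2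
    have key : ((MvPolynomial.aeval (fun _ : Fin 2 => (0 : MvPolynomial (Params n) L)) :
        MvPolynomial (Fin 2) (MvPolynomial (Params n) L) →ₐ[_] _).toRingHom).comp
        (eval₂Hom (C.comp C) (sectSubst (A := L) n)) =
        (rename (fun i : Fin n => (Sum.inr (Sum.inl i) : Params n))).toRingHom := by
      refine MvPolynomial.ringHom_ext (fun a => ?_) (fun i => ?_)
      · simp only [RingHom.coe_comp, Function.comp_apply, eval₂Hom_C, AlgHom.toRingHom_eq_coe,
          RingHom.coe_coe, MvPolynomial.algHom_C, MvPolynomial.algebraMap_eq, Algebra.algebraMap_self_apply]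
      · simp only [RingHom.coe_comp, Function.comp_apply, eval₂Hom_X', AlgHom.toRingHom_eq_coe,
          RingHom.coe_coe, MvPolynomial.aeval_X, sectSubst, map_add, map_mul, MvPolynomial.algHom_C,
          Algebra.algebraMap_self_apply, mul_zero, add_zero, rename_X]
    have h3 := DFunLike.congr_fun key (MvPolynomial.map (Int.castRingHom L) Q)
    simp only [RingHom.coe_comp, Function.comp_apply, AlgHom.toRingHom_eq_coe, RingHom.coe_coe] at h3
    rw [h2] at h3
    exact MvPolynomial.rename_injective _ (Sum.inr_injective.comp Sum.inl_injective) (by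
      rw [map_zero]; exact h3.symm)
  have hφd : φ.totalDegree ≤ d := by
    rw [hφ, totalDegree_map_planeSect]
    exact (Finset.sup_mono (support_map_subset _ _)).trans hQd
  -- the minor does not vanish over `Ω`
  have hcast : (ZMod.castHom (dvd_refl p) L).comp (Int.castRingHom (ZMod p)) = Int.castRingHom L :=
    RingHom.ext_int _ _
  have hmin' : rupMinor d φ rows cs ≠ 0 := by
    rw [hφ, rupMinor_map_planeSect_int ι Q d rows cs, map_ne_zero_iff ι hιinj, ← hcast,
      ← MvPolynomial.map_map]
    exact (map_ne_zero_iff _ (MvPolynomial.map_injective _ (ZMod.castHom (dvd_refl p) L).injective)).mpr hmin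
  -- the sections of the factors
  refine card_add_le_of_rupMinor_ne_zero hchar hφ0 hφd (fun j => MvPolynomial.map ι (planeSect (w j)))
    (fun j => irreducible_map_planeSect (irreducible_map_of_isAlgClosed _ (hw j)))
    (fun j => ?_) (fun j l hjl => not_dvd_map_planeSect (hw j) (hw l) (hna j l hjl)) hmin'
  rw [hφ, planeSect_eq_eval₂Hom, planeSect_eq_eval₂Hom]
  exact map_dvd _ (map_dvd _ (hdvd j))

end Ruppert

end Literature.RingTheory.MvPolynomial

end
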